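import Summits.QuantumFields.BalabanUV.Beta.VertexToriSymmetryCovariantQ

/-!
# TableCovariance — the signed, block-shifted relabelling lemma (β-CAP lane, cap3 gen 15: the LEMMA G6 socket; v3, rebased on an5's
# `VertexToriSymmetryCovariantQ`)

`VertexToriSymmetryCovariantQ` (an5, part 5) transports the one-loop trace algebra under a momentum map `τ` with a `q`-DEPENDENT conjugator
pair, `MatCovariantQ τ U V A : ∀ q, A (τ q) = U q * A q * V q` with `∀ q, V q * U q = 1`, up to the jet END on the vertex tori.  What it
takes as INPUT is the covariance of each table family.  The lane's one-loop stencil tables (SU(2), `L = 3`, `k = 0`, attach mid; cap5's exact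
dumps) are covariant under the two NON-jet coordinate reflections `R₂, R₃` in the following shape (cap3's LEMMA G6, verified exactly,
coefficient-wise, on all 28 tables — `HOME/b2b-balaban-beta-cap3/g15/g6/G6-TABLECOV.md`, data `G6-RELABEL.json`; independently cap5
`pi_maps.json`, cap4 `g6check`/`g6modp` for engine D, cap1 `SYM-A-R2R3.md` for engine A):

* ENTRY FORM  `K (R_ν y + (dl j − dl i) e_ν) (π i) (π j) = s i * s j * K y i j` — a signed relabelling `π` of the indices together with a
  BLOCK SHIFT `dl ∈ {0, −1}` of the offset for the bonds leaving the block through the face `x_ν = +1` and for the `ν`-constraint row;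
* FOURIER FORM  `A (reflectAt ν q) = P_ν(q) * A q * P_ν(q)⁻¹` with the MONOMIAL, `q`-DEPENDENT conjugator `P_ν(q)[π i, i] = s i · e^{i q_ν dl_i}`
  (sign of the exponent tied to the tree's `character x q = cexp (I * Σ_μ x_μ q_μ)` and to tables multiplying `character dR q`).

THIS FILE: ENTRY FORM ⟹ FOURIER FORM, as an instance of an5's `MatCovariantQ`.
§2 the conjugators `relabelConj ν π s dl q = P_ν(q)` and `relabelConjInv ν π s dl q = P_ν(q)⁻¹` (inverse to each other when `s i ^ 2 = 1`),
   their entry formulas, the shifted reflection `shiftRefl ν c y = R_ν y + c e_ν` (an involution for every `c`), the character identity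
   `character (reflectIdx ν (shiftRefl ν c y)) q = character y q · e^{−i c q_ν}`, and the main lemma `matCovariantQ_characterSum_relabel`
   (hypotheses: `K` vanishes off a finite `S`; the ENTRY FORM for all `y, i, j`; conclusion `MatCovariantQ (reflectAt ν) (relabelConj …)
   (relabelConjInv …) (q ↦ Σ_{x ∈ S} character x q • K x)`; no closure hypothesis on `S` — the sums are extended by zero to `S ∪ φ_c S`);
   `matCovariantQ_characterSum_signedPerm`: with `dl ≡ 0` the conjugators are constant and the conclusion is an5's `MatCovariant`.
§3 `relabelConj_shift` / `relabelConjInv_shift`: `P_ν` does not see a jet shift `q − p₁v₁ − p₂v₂` with `(v₁)_ν = (v₂)_ν = 0` (the extra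
   hypothesis of `VertexToriSymmetry.matCovariantQ_shift₃`).
(§1 of v1/v2 — a private copy of the `MatCovariantQ` algebra — and the three-slot/jet END of v2 §3 are DROPPED in v3: they are an5's part 5.)

COURIER NOTE (an5 gen 23, row CAP-k owner): author planner-b2b-balaban-beta-cap3-g15-0, staged bytes sha256[:16] f67b1f4db14b637d
(`HOME/b2b-balaban-beta-cap3/g15/lean/TableCovariance.lean`, journal l.13396; farm rc 0 against the tree, cap3-g16 l.13836); filed by the
row owner with this note added and the code byte-identical.  It supplies the INPUT of `VertexToriSymmetryCovariantQ` from a table identity.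

HONEST FRAMING (cell rule): finite-group bookkeeping for finite lattice one-loop tables; it certifies no number.  Discharging `BetaPertH` would
make Bałaban's UV stability UNCONDITIONAL — NOT the continuum limit, NOT Clay.  All statements are [folklore] linear algebra.
-/

namespace Summit.QuantumFields.BalabanUV.Beta.TableCovariance

open Complex Matrix
open Summit.QuantumFields.BalabanUV.Beta.PolyRegularAlgebra (character)
open Summit.QuantumFields.BalabanUV.Beta.VertexToriSymmetry

noncomputable section

variable {d : ℕ} {n : Type*} [Fintype n] [DecidableEq n]

/-! ## §2 The signed, block-shifted relabelling: conjugators and the table lemma -/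

section Relabel

variable (ν : Fin (d + 1)) (π : Equiv.Perm n) (s : n → ℂ) (dl : n → ℤ)

/-- THE RELABELLING CONJUGATOR `P_ν(q)`: the monomial matrix with `P[π i, i] = s i · e^{i q_ν dl_i}` (G6: `s i = ±1`, `dl i ∈ {0, −1}`). [folklore] -/
def relabelConj (q : Fin (d + 1) → ℂ) : Matrix n n ℂ :=
  Matrix.of fun a b => if a = π b then s b * cexp (I * (dl b : ℂ) * q ν) else 0

/-- ITS INVERSE `P_ν(q)⁻¹`: `P⁻¹[i, π i] = s i · e^{−i q_ν dl_i}` (an inverse as soon as `s i * s i = 1`). [folklore] -/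
def relabelConjInv (q : Fin (d + 1) → ℂ) : Matrix n n ℂ :=
  Matrix.of fun a b => if b = π a then s a * cexp (-(I * (dl a : ℂ) * q ν)) else 0

/-- left action of `P`: `(P * M) (π i) e = s i · e^{i q_ν dl_i} · M i e`. [folklore] -/
theorem relabelConj_mul_apply (q : Fin (d + 1) → ℂ) (M : Matrix n n ℂ) (i e : n) :
    (relabelConj ν π s dl q * M) (π i) e = s i * cexp (I * (dl i : ℂ) * q ν) * M i e := by
  simp only [Matrix.mul_apply, relabelConj, Matrix.of_apply, EmbeddingLike.apply_eq_iff_eq, ite_mul, zero_mul,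
    Finset.sum_ite_eq, Finset.mem_univ, if_true]

/-- right action of `P⁻¹`: `(M * P⁻¹) a (π j) = M a j · s j · e^{−i q_ν dl_j}`. [folklore] -/
theorem mul_relabelConjInv_apply (q : Fin (d + 1) → ℂ) (M : Matrix n n ℂ) (a j : n) :
    (M * relabelConjInv ν π s dl q) a (π j) = M a j * (s j * cexp (-(I * (dl j : ℂ) * q ν))) := by
  simp only [Matrix.mul_apply, relabelConjInv, Matrix.of_apply, EmbeddingLike.apply_eq_iff_eq, mul_ite, mul_zero,
    Finset.sum_ite_eq, Finset.mem_univ, if_true]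

/-- the ENTRY FORMULA of the conjugation: `(P M P⁻¹)[π i, π j] = s i · s j · e^{i q_ν (dl i − dl j)} · M[i, j]`. [folklore] -/
theorem relabel_conj_apply (q : Fin (d + 1) → ℂ) (M : Matrix n n ℂ) (i j : n) :
    (relabelConj ν π s dl q * M * relabelConjInv ν π s dl q) (π i) (π j)
      = s i * s j * cexp (I * ((dl i : ℂ) - dl j) * q ν) * M i j := by
  rw [mul_relabelConjInv_apply, relabelConj_mul_apply]
  have e : cexp (I * ((dl i : ℂ) - dl j) * q ν) = cexp (I * (dl i : ℂ) * q ν) * cexp (-(I * (dl j : ℂ) * q ν)) := by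
    rw [← Complex.exp_add]; ring_nf
  rw [e]; ring

/-- `P⁻¹ * P = 1` when the signs square to one. [folklore] -/
theorem relabelConjInv_mul (hs : ∀ i, s i * s i = 1) (q : Fin (d + 1) → ℂ) :
    relabelConjInv ν π s dl q * relabelConj ν π s dl q = 1 := by
  ext a b
  have h1 : (relabelConjInv ν π s dl q * relabelConj ν π s dl q) a b
      = s a * cexp (-(I * (dl a : ℂ) * q ν)) * (if π a = π b then s b * cexp (I * (dl b : ℂ) * q ν) else 0) := by
    simp only [Matrix.mul_apply, relabelConjInv, relabelConj, Matrix.of_apply]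
    rw [Finset.sum_eq_single (π a)]
    · rw [if_pos rfl]
    · intro c _ hc; rw [if_neg hc, zero_mul]
    · intro h; exact absurd (Finset.mem_univ _) h
  rw [h1, Matrix.one_apply]
  by_cases h : a = b
  · subst h
    rw [if_pos (rfl : π a = π a), if_pos (rfl : a = a)]
    calc s a * cexp (-(I * (dl a : ℂ) * q ν)) * (s a * cexp (I * (dl a : ℂ) * q ν))
        = (s a * s a) * (cexp (-(I * (dl a : ℂ) * q ν)) * cexp (I * (dl a : ℂ) * q ν)) := by ring
      _ = 1 := by rw [hs a, ← Complex.exp_add, neg_add_cancel, Complex.exp_zero, one_mul]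
  · rw [if_neg (fun e => h (π.injective e)), if_neg h, mul_zero]

/-- `P * P⁻¹ = 1` likewise. [folklore] -/
theorem relabelConj_mul_inv (hs : ∀ i, s i * s i = 1) (q : Fin (d + 1) → ℂ) :
    relabelConj ν π s dl q * relabelConjInv ν π s dl q = 1 :=
  mul_eq_one_comm.mp (relabelConjInv_mul ν π s dl hs q)

omit [Fintype n] in
/-- `P_ν(q)` depends on `q` only through `q_ν`: a shift by `p` with `p_ν = 0` is not seen. [folklore] -/
theorem relabelConj_sub {p : Fin (d + 1) → ℂ} (hp : p ν = 0) (q : Fin (d + 1) → ℂ) :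
    relabelConj ν π s dl (q - p) = relabelConj ν π s dl q := by
  ext a b; simp [relabelConj, hp]

omit [Fintype n] in
/-- same for `P⁻¹`. [folklore] -/
theorem relabelConjInv_sub {p : Fin (d + 1) → ℂ} (hp : p ν = 0) (q : Fin (d + 1) → ℂ) :
    relabelConjInv ν π s dl (q - p) = relabelConjInv ν π s dl q := by
  ext a b; simp [relabelConjInv, hp]

/-- THE SHIFTED REFLECTION of an offset: `shiftRefl ν c y = R_ν y + c e_ν`, i.e. `y` with its `ν`-component replaced by `c − y_ν`. [folklore] -/
def shiftRefl (c : ℤ) (y : Fin (d + 1) → ℤ) : Fin (d + 1) → ℤ := Function.update y ν (c - y ν)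

/-- the reflected-and-shifted component. [folklore] -/
@[simp] theorem shiftRefl_apply_same (c : ℤ) (y : Fin (d + 1) → ℤ) : shiftRefl ν c y ν = c - y ν := by
  simp [shiftRefl]

/-- the other components are unchanged. [folklore] -/
@[simp] theorem shiftRefl_apply_ne {μ : Fin (d + 1)} (h : μ ≠ ν) (c : ℤ) (y : Fin (d + 1) → ℤ) : shiftRefl ν c y μ = y μ := by
  simp [shiftRefl, Function.update_of_ne h]

/-- it is `reflectIdx ν` followed by the translation by `c e_ν`. [folklore] -/
theorem shiftRefl_eq (c : ℤ) (y : Fin (d + 1) → ℤ) : shiftRefl ν c y = reflectIdx ν y + Pi.single ν c := by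
  funext μ
  by_cases h : μ = ν
  · subst h; simp; ring
  · simp [h]

/-- `shiftRefl ν 0 = reflectIdx ν`. [folklore] -/
theorem shiftRefl_zero (y : Fin (d + 1) → ℤ) : shiftRefl ν 0 y = reflectIdx ν y := by
  rw [shiftRefl_eq]; simp

/-- each `shiftRefl ν c` is an INVOLUTION. [folklore] -/
theorem shiftRefl_shiftRefl (c : ℤ) (y : Fin (d + 1) → ℤ) : shiftRefl ν c (shiftRefl ν c y) = y := by
  funext μ
  by_cases h : μ = ν
  · subst h; simp
  · simp [h]

/-- a character at an UPDATED frequency: `character (update y ν v) q = character y q · e^{i (v − y_ν) q_ν}`. [folklore] -/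
theorem character_update (y : Fin (d + 1) → ℤ) (v : ℤ) (q : Fin (d + 1) → ℂ) :
    character (Function.update y ν v) q = character y q * cexp (I * ((v : ℂ) - y ν) * q ν) := by
  unfold character
  rw [← Complex.exp_add]
  congr 1
  have e1 : ∑ μ, ((Function.update y ν v μ : ℤ) : ℂ) * q μ = (v : ℂ) * q ν + ∑ k : Fin d, ((y (ν.succAbove k) : ℤ) : ℂ) * q (ν.succAbove k) := by
    rw [Fin.sum_univ_succAbove _ ν, Function.update_self]
    congr 1
    refine Finset.sum_congr rfl fun k _ => ?_
    rw [Function.update_of_ne (Fin.succAbove_ne ν k)]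
  have e2 : ∑ μ, ((y μ : ℤ) : ℂ) * q μ = (y ν : ℂ) * q ν + ∑ k : Fin d, ((y (ν.succAbove k) : ℤ) : ℂ) * q (ν.succAbove k) := by
    rw [Fin.sum_univ_succAbove _ ν]
  rw [e1, e2]; ring

/-- the character identity behind G6: `character (R_ν (shiftRefl ν c y)) q = character y q · e^{−i c q_ν}`. [folklore] -/
theorem character_reflectIdx_shiftRefl (c : ℤ) (y : Fin (d + 1) → ℤ) (q : Fin (d + 1) → ℂ) :
    character (reflectIdx ν (shiftRefl ν c y)) q = character y q * cexp (-(I * (c : ℂ) * q ν)) := by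
  have e : reflectIdx ν (shiftRefl ν c y) = Function.update y ν (y ν - c) := by
    funext μ
    by_cases h : μ = ν
    · subst h; simp
    · simp [h]
  rw [e, character_update]
  congr 1
  push_cast
  ring_nf

omit [Fintype n] [DecidableEq n] in
/-- entries of a character sum. [folklore] -/
theorem characterSum_apply (S : Finset (Fin (d + 1) → ℤ)) (K : (Fin (d + 1) → ℤ) → Matrix n n ℂ) (q : Fin (d + 1) → ℂ) (a b : n) :
    (∑ x ∈ S, character x q • K x) a b = ∑ x ∈ S, character x q * K x a b := by
  simp only [Matrix.sum_apply, Matrix.smul_apply, smul_eq_mul]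

/-- **LEMMA G6 SOCKET — ENTRY FORM ⟹ FOURIER FORM.**  Let `K` be a table family supported in the finite offset set `S`, and suppose the
signed, block-shifted relabelling identity `K (R_ν y + (dl j − dl i) e_ν) (π i) (π j) = s i · s j · K y i j` holds for all `y, i, j`.  Then the
stencil family `A q = Σ_{x ∈ S} character x q • K x` is covariant under `q_ν ↦ −q_ν` with the `q`-dependent conjugators `P_ν(q), P_ν(q)⁻¹`:
`A (reflectAt ν q) = P_ν(q) * A q * P_ν(q)⁻¹`.  (Proof: entrywise at `(π i, π j)`; both sums are extended by zero to `S ∪ shiftRefl(S)`, which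
IS closed under the involution `shiftRefl ν (dl j − dl i)`, and reindexed by it.)  This is cap3's G6 (a) ⟹ (b) for the lane's 28 tables. [folklore] -/
theorem matCovariantQ_characterSum_relabel (S : Finset (Fin (d + 1) → ℤ)) (K : (Fin (d + 1) → ℤ) → Matrix n n ℂ)
    (hK0 : ∀ x, x ∉ S → K x = 0)
    (hK : ∀ y i j, K (shiftRefl ν (dl j - dl i) y) (π i) (π j) = s i * s j * K y i j) :
    MatCovariantQ (reflectAt ν) (relabelConj ν π s dl) (relabelConjInv ν π s dl) (fun q => ∑ x ∈ S, character x q • K x) := by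
  classical
  intro q
  ext a b
  obtain ⟨i, rfl⟩ := π.surjective a
  obtain ⟨j, rfl⟩ := π.surjective b
  show (∑ x ∈ S, character x (reflectAt ν q) • K x) (π i) (π j)
    = (relabelConj ν π s dl q * (∑ x ∈ S, character x q • K x) * relabelConjInv ν π s dl q) (π i) (π j)
  rw [relabel_conj_apply, characterSum_apply, characterSum_apply, Finset.mul_sum]
  set c : ℤ := dl j - dl i with hc
  set T : Finset (Fin (d + 1) → ℤ) := S ∪ S.image (shiftRefl ν c) with hT
  have hST : S ⊆ T := Finset.subset_union_left
  have hTcl : ∀ y ∈ T, shiftRefl ν c y ∈ T := by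
    intro y hy
    rcases Finset.mem_union.mp hy with h | h
    · exact Finset.mem_union_right _ (Finset.mem_image_of_mem _ h)
    · obtain ⟨z, hz, rfl⟩ := Finset.mem_image.mp h
      rw [shiftRefl_shiftRefl]; exact hST hz
  -- extend both sums by zero to `T`
  have eL : ∑ x ∈ S, character x (reflectAt ν q) * K x (π i) (π j) = ∑ x ∈ T, character (reflectIdx ν x) q * K x (π i) (π j) := by
    rw [← Finset.sum_subset hST (fun x _ hx => by rw [hK0 x hx]; simp)]
    exact Finset.sum_congr rfl fun x _ => by rw [character_reflectAt]
  have hK' : ∀ y, K (shiftRefl ν c y) (π i) (π j) = s i * s j * K y i j := fun y => by rw [hc]; exact hK y i j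
  have eR : ∑ x ∈ S, s i * s j * cexp (I * ((dl i : ℂ) - dl j) * q ν) * (character x q * K x i j)
      = ∑ y ∈ T, character (reflectIdx ν (shiftRefl ν c y)) q * K (shiftRefl ν c y) (π i) (π j) := by
    calc ∑ x ∈ S, s i * s j * cexp (I * ((dl i : ℂ) - dl j) * q ν) * (character x q * K x i j)
        = ∑ x ∈ T, s i * s j * cexp (I * ((dl i : ℂ) - dl j) * q ν) * (character x q * K x i j) :=
          Finset.sum_subset hST (fun x _ hx => by rw [hK0 x hx]; simp)
      _ = ∑ y ∈ T, character (reflectIdx ν (shiftRefl ν c y)) q * K (shiftRefl ν c y) (π i) (π j) := by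
          refine Finset.sum_congr rfl fun y _ => ?_
          rw [hK' y, character_reflectIdx_shiftRefl, hc]
          push_cast
          have e : cexp (-(I * ((dl j : ℂ) - dl i) * q ν)) = cexp (I * ((dl i : ℂ) - dl j) * q ν) := by ring_nf
          rw [e]; ring
  rw [eL, eR]
  -- reindex by the involution `shiftRefl ν c` of `T`
  exact Finset.sum_bij' (fun y _ => shiftRefl ν c y) (fun x _ => shiftRefl ν c x) hTcl hTcl
    (fun y _ => shiftRefl_shiftRefl ν c y) (fun x _ => shiftRefl_shiftRefl ν c x) (fun y _ => by rw [shiftRefl_shiftRefl])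

/-- the unshifted special case `dl = 0` recovers an5's `matCovariant_characterSum_reflectAt` shape with a SIGNED PERMUTATION conjugator
(`K (R_ν y) (π i) (π j) = s i s j K y i j`), now without any closure hypothesis on `S`. [folklore] -/
theorem matCovariantQ_characterSum_signedPerm (S : Finset (Fin (d + 1) → ℤ)) (K : (Fin (d + 1) → ℤ) → Matrix n n ℂ)
    (hK0 : ∀ x, x ∉ S → K x = 0)
    (hK : ∀ y i j, K (reflectIdx ν y) (π i) (π j) = s i * s j * K y i j) :
    MatCovariantQ (reflectAt ν) (relabelConj ν π s (fun _ => 0)) (relabelConjInv ν π s (fun _ => 0))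
      (fun q => ∑ x ∈ S, character x q • K x) :=
  matCovariantQ_characterSum_relabel ν π s (fun _ => 0) S K hK0 (fun y i j => by rw [sub_self, shiftRefl_zero]; exact hK y i j)

end Relabel

/-! ## §3 The relabelling conjugators do not see a jet shift orthogonal to `e_ν` (for `VertexToriSymmetry.matCovariantQ_shift₃`) -/

section Shift

omit [Fintype n] in
/-- `relabelConj ν` does not see a shift along directions with vanishing `ν`-component. [folklore] -/
theorem relabelConj_shift (ν : Fin (d + 1)) (π : Equiv.Perm n) (s : n → ℂ) (dl : n → ℤ) {v₁ v₂ : Fin (d + 1) → ℝ}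
    (h₁ : v₁ ν = 0) (h₂ : v₂ ν = 0) (q : Fin (d + 1) → ℂ) (p₁ p₂ : ℂ) :
    relabelConj ν π s dl (fun i => q i - (v₁ i : ℂ) * p₁ - (v₂ i : ℂ) * p₂) = relabelConj ν π s dl q := by
  ext a b; simp [relabelConj, h₁, h₂]

omit [Fintype n] in
/-- same for `relabelConjInv ν`. [folklore] -/
theorem relabelConjInv_shift (ν : Fin (d + 1)) (π : Equiv.Perm n) (s : n → ℂ) (dl : n → ℤ) {v₁ v₂ : Fin (d + 1) → ℝ}
    (h₁ : v₁ ν = 0) (h₂ : v₂ ν = 0) (q : Fin (d + 1) → ℂ) (p₁ p₂ : ℂ) :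
    relabelConjInv ν π s dl (fun i => q i - (v₁ i : ℂ) * p₁ - (v₂ i : ℂ) * p₂) = relabelConjInv ν π s dl q := by
  ext a b; simp [relabelConjInv, h₁, h₂]

end Shift

end

end Summit.QuantumFields.BalabanUV.Beta.TableCovariance
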